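import Mathlib
import Literature.Probability.Process.RootedHardCoreConfig
import HarnessLib

/-!
# `GappedShellCensus.RadialDefectsVanish` (stmt-AtomisticToContinuum-15930), line `all-twelve-gap`:
# RESTRICTION — every strict finite-radius certificate `LTG_R` closes `AllTwelveGap`
# (registered stub `allTwelveGap_of_ltgStrict`, PROVED by name + signature)

The converse bookkeeping of the compactness theorem `ltgOfAllTwelveGap`: if for SOME radius `R` every site of
a finite configuration of `ℝ³` that is locally twelve out to `R` (hard core `55/57` out to `11/10` around it and
exactly twelve other sites within `1`) has every other site at distance `≤ 1` or `> 21/17` (the strict finite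
locally-twelve gap statement `LTG_R`, to be supplied by a certified computation), then every
everywhere-locally-twelve `55/57`-separated point set `Y ⊂ ℝ³` has no pair at distance in `(1, 21/17]`
(`AllTwelveGap`, the own stub `stub_allTwelveGap`).  Proof: restrict `Y` to the closed ball of radius
`max R (21/17) + 2` around the site `y`; this is a FINITE set (`LocalConfig.finite_inter_of_separated`), enumerate
it by `Fin N` (`Set.Finite.fin_embedding`), check that local twelve-ness is inherited from `Y` inside the
`R`-ball around `y` (the twelve neighbours of such a site lie at distance `≤ R + 1` from `y`, inside the ball),
and apply `LTG_R` at the index of `y`.  Standalone (imports `Mathlib`, the local-rubber library, `HarnessLib` only).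
-/

noncomputable section

open Metric
open Literature.Probability.Process

namespace Summit.AtomisticToContinuum.Crystallization.Theorems

/-- **RESTRICTION (`allTwelveGap_of_ltgStrict` of line `all-twelve-gap`, PROVED).**  If at SOME locality radius
`R` every site of a finite configuration of `ℝ³` that is locally twelve out to `R` has every other site at distance
`≤ 1` or `> 21/17` (strict `LTG_R`), then every `55/57`-separated point set of `ℝ³` all of whose sites have exactly
twelve other sites within distance `1` has no pair of sites at distance in `(1, 21/17]` (`AllTwelveGap`): restrict the
set to a large closed ball around a site (a finite set, by the hard core) and apply `LTG_R` there. [folklore] -/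
theorem allTwelveGap_of_ltgStrict :
    (∃ R : ℝ, ∀ (N : ℕ) (X : Fin N → EuclideanSpace ℝ (Fin 3)) (i : Fin N),
      (∀ j : Fin N, dist (X i) (X j) ≤ R →
        (∀ k : Fin N, dist (X j) (X k) ≤ 11 / 10 → ∀ l : Fin N, l ≠ k → (55 : ℝ) / 57 ≤ dist (X k) (X l)) ∧
        (Finset.univ.filter fun k : Fin N => k ≠ j ∧ dist (X j) (X k) ≤ 1).card = 12) →
      ∀ j : Fin N, j ≠ i → dist (X i) (X j) ≤ 1 ∨ (21 : ℝ) / 17 < dist (X i) (X j)) →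
    ∀ Y : Set (EuclideanSpace ℝ (Fin 3)),
      (∀ y ∈ Y, (∀ w ∈ Y, w ≠ y → (55 : ℝ) / 57 ≤ dist y w) ∧ {w ∈ Y | w ≠ y ∧ dist y w ≤ 1}.ncard = 12) →
      ∀ y ∈ Y, ∀ w ∈ Y, w ≠ y → dist y w ≤ 1 ∨ (21 : ℝ) / 17 < dist y w := by
  rintro ⟨R, hR⟩ Y hY y hy w hw hwy
  by_cases hlt : (21 : ℝ) / 17 < dist y w
  · exact Or.inr hlt
  push Not at hlt
  -- the hard core of `Y`, in the symmetric form
  have hYsep : ∀ x ∈ Y, ∀ x' ∈ Y, x ≠ x' → (55 : ℝ) / 57 ≤ dist x x' :=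
    fun x hx x' hx' hne => (hY x hx).1 x' hx' (Ne.symm hne)
  -- the finite window around `y`
  set R' : ℝ := max R (21 / 17) with hR'
  have hRR' : R ≤ R' := le_max_left _ _
  have h21R' : (21 : ℝ) / 17 ≤ R' := le_max_right _ _
  have hTfin : (closedBall y (R' + 2) ∩ Y).Finite :=
    LocalConfig.finite_inter_of_separated (by norm_num) hYsep (isCompact_closedBall y (R' + 2))
  obtain ⟨N, f, hf⟩ := hTfin.fin_embedding
  have hfT : ∀ k : Fin N, f k ∈ closedBall y (R' + 2) ∩ Y := fun k => by
    rw [← hf]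
    exact Set.mem_range_self k
  have hfY : ∀ k : Fin N, f k ∈ Y := fun k => (hfT k).2
  have hsurj : ∀ p ∈ Y, dist p y ≤ R' + 2 → ∃ k : Fin N, f k = p := fun p hp hd => by
    have h : p ∈ Set.range f := by
      rw [hf]
      exact ⟨mem_closedBall.2 hd, hp⟩
    exact Set.mem_range.1 h
  -- the indices of `y` and `w`
  obtain ⟨i, hi⟩ := hsurj y hy (by rw [dist_self]; linarith)
  obtain ⟨j₀, hj₀⟩ := hsurj w hw (by rw [dist_comm]; linarith)
  have hji : j₀ ≠ i := by
    rintro rfl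
    exact hwy (hj₀.symm.trans hi)
  -- apply the finite-radius certificate to the window, at the index of `y`
  have key : dist (f i) (f j₀) ≤ 1 ∨ (21 : ℝ) / 17 < dist (f i) (f j₀) := by
    refine hR N f i (fun j hj => ⟨fun k _ l hlk => ?_, ?_⟩) j₀ hji
    · -- (a) hard core: distinct indices are distinct sites of `Y`
      exact hYsep _ (hfY k) _ (hfY l) fun h => hlk (f.injective h).symm
    · -- (b) exactly twelve other sites within `1`: they all lie in the window
      rw [hi] at hj
      have hset : (((Finset.univ.filter fun k : Fin N => k ≠ j ∧ dist (f j) (f k) ≤ 1).map f :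
          Finset (EuclideanSpace ℝ (Fin 3))) : Set (EuclideanSpace ℝ (Fin 3))) =
          {w' ∈ Y | w' ≠ f j ∧ dist (f j) w' ≤ 1} := by
        ext w'
        simp only [Finset.mem_coe, Finset.mem_map, Finset.mem_filter, Finset.mem_univ, true_and,
          Set.mem_setOf_eq]
        constructor
        · rintro ⟨k, ⟨hkj, hd⟩, rfl⟩
          exact ⟨hfY k, fun h => hkj (f.injective h), hd⟩
        · rintro ⟨hw'Y, hw'j, hd⟩
          obtain ⟨k, rfl⟩ := hsurj w' hw'Y (by
            calc dist w' y ≤ dist w' (f j) + dist (f j) y := dist_triangle _ _ _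
              _ ≤ 1 + R := by
                rw [dist_comm w' (f j), dist_comm (f j) y]
                exact add_le_add hd hj
              _ ≤ R' + 2 := by linarith)
          exact ⟨k, ⟨fun h => hw'j (by rw [h]), hd⟩, rfl⟩
      rw [← Finset.card_map f, ← Set.ncard_coe_finset, hset]
      exact (hY (f j) (hfY j)).2
  rw [hi, hj₀] at key
  exact key

end Summit.AtomisticToContinuum.Crystallization.Theorems

end
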